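import Summits.BirchSwinnertonDyer.BirchSwinnertonDyer.Theorems.AlignedTransportAtTwoMainConjectureOfRankZeroBSDAtTwoTwistReadingLayerOne
import Literature.NumberTheory.EllipticCurves.PAdicLFunctionZeroAtMinusTwoProofs
import Literature.NumberTheory.EllipticCurves.AnalyticRankOrderProofs
import Literature.NumberTheory.EllipticCurves.Wuthrich2014.PAdicBSDInequalityProofs
import Literature.NumberTheory.LFunctions.DirichletLValueBernoulli
import HarnessLib

/-!
# Route `AlignedTransportAtTwo`, crux C2 `MainConjectureOfRankZeroBSDAtTwo` (stmt-BirchSwinnertonDyer-22298):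
# THE TWIST READING, ANALYTIC SIDE — `(T+2) ∣ L₂(W,T) ⟺ L(W⁽²⁾, 1) = 0` (the tree had `⟸`); hence, modulo Kato 17.4 (1)(2) at `2` for `W`:
# `L(W⁽²⁾,1) ≠ 0 ⟹ Sel_{2^∞}(W⁽²⁾/ℚ)` has `ℤ₂`-corank `0` (`rank W⁽²⁾(ℚ) = 0`, `Ш(W⁽²⁾/ℚ)[2^∞]` finite) and `corank Sel_{2^∞}(W/ℚ(√2)) = corank Sel_{2^∞}(W/ℚ)`

HONEST FRAMING (cell `bsd-f1-sign2`, WIDTH-5 attached prover seat `bsd-line-att-p5` gen 38 on line `birth` of the lead `bsd-line-att-p2`;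
`--supports` stmt-BirchSwinnertonDyer-22298, closes nothing; BSD is NOT proved by any of this; the crux C2, its verdict «blocked-on
`Rank1Residual.GreenbergMuConjectureIrreducible`» and every registered stub are untouched). THEOREMS ONLY — no `def`, no instance, no named fact, no `sorry`.
PRINT binder `h17` (Kato 17.4 (1)(2) at `2`) in §3 only; §1–§2 use no named fact (MTT interpolation at `χ₈`, Birch's formula, Gauss-sum non-vanishing and the analytic-rank
dictionary are tree THEOREMS). Sequel of `…TwistReading{,Bounds,LayerOne}`.

* §1 `hasSum_coeff_mul_pow_zero_of_X_sub_C_dvd` — **`(T − a) ∣ g`, `‖a‖ < 1` ⟹ `∑ g_k a^k = 0`** in `ℤ_p` (converse of the tree's `PadicInt.X_sub_C_dvd_of_hasSum_zero`; telescoping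
  partial sums `∑_{k<K} g_k a^k = −h_{K−1} a^K`).
* §2 ★★ `not_X_add_C_two_dvd_of_analyticRank_quadraticTwist_two_eq_zero` — for `W` globally minimal, good ordinary at `2`, newform `f`, integral lift `G` of `L₂(f,α)`:
  **`r_an(W⁽²⁾) = 0 ⟹ (T+2) ∤ G`** (`G(−2) = α⁻³·S₈(f)` by MTT at `χ₈`; `S₈(f)·Ω⁺_f = τ(χ₈)·L(W⁽²⁾,1)`, `τ(χ₈) ≠ 0`); with the tree's converse,
  ★★ `X_add_C_two_dvd_iff_analyticRank_quadraticTwist_two_ne_zero`: **`(T+2) ∣ L₂(W,T) ⟺ L(W⁽²⁾, 1) = 0`** — the analytic matching law at the order-`2` character, two-sided.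
* §3 (PRINT `h17`) ★★ `selmerCorank_twist_eq_zero_of_analyticRank_quadraticTwist_two_eq_zero` — **`L(W⁽²⁾,1) ≠ 0 ⟹ corank_{ℤ₂} Sel_{2^∞}(W⁽²⁾/ℚ) = 0`, `rank W⁽²⁾(ℚ) = 0`,
  `Ш(W⁽²⁾/ℚ)[2^∞]` FINITE** for every `ℚ`-model of the additive twist (Kato's Cor. 14.3 for `W⁽²⁾` at `p = 2`, obtained from 17.4 for the GOOD curve `W` through the tower);
  ★ `selmerCorank_layer_one_eq_of_analyticRank_quadraticTwist_two_eq_zero` — **`L(W⁽²⁾,1) ≠ 0 ⟹ corank_{ℤ₂} Sel_{2^∞}(W/ℚ(√2)) = corank_{ℤ₂} Sel_{2^∞}(W/ℚ)`**: no Selmer growth in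
  the first layer of the cyclotomic `ℤ₂`-tower (the `⟹` half of the layer-one matching law on the Selmer side; the `⟸` half is the missing control for the additive twist).

References: B. Mazur, J. Tate, J. Teitelbaum, Invent. Math. 84 (1986) §I.8 (8.6), §I.14 [MazurTateTeitelbaum1986Invent]; K. Kato, Astérisque 295 (2004), Thm. 14.2/Cor. 14.3,
Thm. 17.4 [Kato2004Asterisque]; R. Greenberg, LNM 1716 (1999), §3 Lemma 3.1, §4 p. 107 [GreenbergLNM1716]; T. and V. Dokchitser, Ann. of Math. 172 (2010), Lemma 4.14
[DokchitserDokchitserAnnals2010].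
-/

set_option linter.dupNamespace false
set_option autoImplicit false

noncomputable section

open scoped Classical MatrixGroups ModularForm

namespace Summit.BirchSwinnertonDyer.BirchSwinnertonDyer.Theorems.AlignedTransportAtTwoTwistReadingAnalytic

open Filter Topology PowerSeries CongruenceSubgroup WeierstrassCurve Literature.NumberTheory.EllipticCurves
  Literature.NumberTheory.EllipticCurves.ModularForms
  Literature.NumberTheory.EllipticCurves.Rank1Residual
  Literature.NumberTheory.EllipticCurves.Greenberg1999
  Summit.BirchSwinnertonDyer.Rank1Residual
  Summit.BirchSwinnertonDyer.Rank1Residual.F1Sign2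
  Summit.BirchSwinnertonDyer.BirchSwinnertonDyer.Theorems.Rank1ResidualX1Defs
  Summit.BirchSwinnertonDyer.BirchSwinnertonDyer.Theorems.AlignedTransportAtTwoTwistReading
  Summit.BirchSwinnertonDyer.BirchSwinnertonDyer.Theorems.AlignedTransportAtTwoTwistReadingLayerOne

/-! ## §1 `(T − a) ∣ g ⟹ ∑ g_k a^k = 0` in `ℤ_p` -/

section PAdic

variable {p : ℕ} [Fact p.Prime]

/-- Telescoping: the partial sums of `∑ g_k a^k` for `g = (T − a)·h` are `−(T·h)_K · a^K`. [folklore] -/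
theorem sum_range_coeff_mul_pow_of_eq_X_sub_C_mul {a : ℤ_[p]} {h : PowerSeries ℤ_[p]} (K : ℕ) :
    ∑ k ∈ Finset.range K, coeff k ((X - C a) * h) * a ^ k = -(coeff K (X * h)) * a ^ K := by
  induction K with
  | zero => simp
  | succ K ih =>
    rw [Finset.sum_range_succ, ih, sub_mul, map_sub, coeff_succ_X_mul, coeff_C_mul]
    rcases K with _ | K
    · simp [mul_comm]
    · rw [coeff_succ_X_mul]; ring

/-- **`(T − a) ∣ g` with `‖a‖ < 1` ⟹ `∑_k g_k a^k = 0` in `ℤ_p`** (the series converges; its partial sums are `−h_{K−1} a^K → 0`). Converse of the tree's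
`PadicInt.X_sub_C_dvd_of_hasSum_zero`. [folklore] -/
theorem hasSum_coeff_mul_pow_zero_of_X_sub_C_dvd {g : PowerSeries ℤ_[p]} {a : ℤ_[p]} (ha : ‖a‖ < 1) (hdvd : (X - C a) ∣ g) :
    HasSum (fun k : ℕ ↦ coeff k g * a ^ k) 0 := by
  obtain ⟨h, rfl⟩ := hdvd
  have hsum := PadicInt.summable_coeff_mul_pow ((X - C a) * h) ha
  have ht : Tendsto (fun K : ℕ ↦ ∑ k ∈ Finset.range K, coeff k ((X - C a) * h) * a ^ k) atTop
      (𝓝 (∑' k, coeff k ((X - C a) * h) * a ^ k)) := hsum.hasSum.tendsto_sum_nat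
  have h0 : Tendsto (fun K : ℕ ↦ ∑ k ∈ Finset.range K, coeff k ((X - C a) * h) * a ^ k) atTop (𝓝 0) := by
    have hpow : Tendsto (fun K : ℕ ↦ ‖a‖ ^ K) atTop (𝓝 0) := tendsto_pow_atTop_nhds_zero_of_lt_one (norm_nonneg _) ha
    refine squeeze_zero_norm (fun K ↦ ?_) hpow
    rw [sum_range_coeff_mul_pow_of_eq_X_sub_C_mul, norm_mul, norm_neg, norm_pow]
    exact mul_le_of_le_one_left (by positivity) (PadicInt.norm_le_one _)
  have heq : (∑' k, coeff k ((X - C a) * h) * a ^ k) = 0 := tendsto_nhds_unique ht h0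
  rw [← heq]
  exact hsum.hasSum

end PAdic

/-! ## §2 `r_an(W⁽²⁾) = 0 ⟹ (T+2) ∤ L₂(W,T)`; the two-sided criterion -/

section Analytic

variable {W : WeierstrassCurve ℚ} [W.IsElliptic] [W.IsGloballyMinimal] {N : ℕ} [NeZero N] {f : CuspForm (Gamma0 N) 2}

omit [W.IsGloballyMinimal] in
/-- **`S₈(f) ≠ 0` when `L(W⁽²⁾, 1) ≠ 0`** (`r_an(W⁽²⁾) = 0`): Birch's formula `S₈(f)·Ω⁺_f = τ(χ₈)·L(W⁽²⁾,1)` (tree theorem), `τ(χ₈) ≠ 0` (primitive), `L(W⁽²⁾,1) ≠ 0` (the analytic-rank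
dictionary for the entire `L`-function of the twist). [cite: MazurTateTeitelbaum1986Invent, §I.8 (8.6)] -/
theorem ratTwistedSymbolSum_χ₈_ne_zero_of_analyticRank_eq_zero (hf : IsNewformOf W f) (hgood : W.HasGoodReductionAtPrime 2)
    (hr : (W.quadraticTwist 2).analyticRank = 0) : ratTwistedSymbolSum f (ZMod.χ₈.ringHomComp (Int.castRingHom ℂ)) ≠ 0 := by
  haveI : (W.quadraticTwist (2 : ℚ)).IsElliptic := W.isElliptic_quadraticTwist two_ne_zero
  set χ := ZMod.χ₈.ringHomComp (Int.castRingHom ℂ) with hχdef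
  have hadd : ∀ v : IsDedekindDomain.HeightOneSpectrum (NumberField.RingOfIntegers ℚ), (Rat.HeightOneSpectrum.primesEquiv v : ℕ) = 2 →
      (W.quadraticTwist 2).HasAdditiveReductionAt v := fun v hv ↦
    (W.hasAdditiveReductionAt_quadraticTwist_two_of_hasGoodReductionAt
      (hasGoodReductionAt_of_natGenerator_eq_two hgood) v hv).1
  have hco : ∀ n : ℕ, (((W.quadraticTwist 2).LFunction n : ℤ) : ℂ) = χ n * cuspCoeff f n :=
    fun n ↦ by rw [W.LFunction_quadraticTwist_two_apply_complex hadd n, hf.2 n]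
  have hE : (W.quadraticTwist 2).HasEntireLFunction :=
    hasEntireLFunction_of_coeff_of_isPrimitive _ f isQuadratic_χ₈_ringHomComp isPrimitive_χ₈_ringHomComp hco
  have hL1 : (W.quadraticTwist 2).entireLFunction 1 ≠ 0 := ((W.quadraticTwist 2).analyticRank_eq_zero_iff_holds hE).mp hr
  have hinv : χ⁻¹ = χ := isQuadratic_χ₈_ringHomComp.inv
  have hBirch := ratTwistedSymbolSum_mul_plusPeriod_holds hf.1 hf.coeffField_eq_bot
    (χ := χ) isPrimitive_χ₈_ringHomComp χ₈_ringHomComp_neg_one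
    ((W.quadraticTwist 2).differentiable_entireLFunction hE) (fun s hs ↦ by
      have hs' : (3 / 2 : ℝ) < s.re := by have : (2 : ℝ) < s.re := hs; linarith
      rw [hinv, (W.quadraticTwist 2).entireLFunction_eq_LSeries hE hs', LSeries_eq_twistedLSeries_of_coeff _ f χ hco])
  have hτ : gaussSum χ (ZMod.stdAddChar (N := 8)) ≠ 0 := Literature.NumberTheory.LFunctions.gaussSum_ne_zero χ isPrimitive_χ₈_ringHomComp
  intro h0
  rw [h0, zero_mul] at hBirch
  exact mul_ne_zero hτ hL1 hBirch.symm

/-- ★★ **`r_an(W⁽²⁾) = 0 ⟹ (T+2) ∤ G`** for the integral lift `G` of `L₂(f,α)` (`W` globally minimal, good ordinary at `2`, `f` a newform of `W`): if `(T+2) ∣ G` then `∑ G_k(−2)^k = 0` (§1),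
whose image in `ℂ₂` is `α⁻³·S₈(f)` (MTT at `χ₈`), so `S₈(f) = 0`, contradicting the previous theorem. [cite: MazurTateTeitelbaum1986Invent, §I.14 Proposition (p. 20), §I.8 (8.6)] -/
theorem not_X_add_C_two_dvd_of_analyticRank_quadraticTwist_two_eq_zero (hord : IsOrdinaryAt W 2) (hf : IsNewformOf W f)
    {G : IwasawaAlgebra 2} (hG : iwasawaToPowerSeries 2 G = padicLFunction f (unitRoot W 2 : ℚ_[2]))
    (hr : (W.quadraticTwist 2).analyticRank = 0) : ¬ (X + C (2 : ℤ_[2])) ∣ G := by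
  intro hdvd
  have hS := ratTwistedSymbolSum_χ₈_ne_zero_of_analyticRank_eq_zero hf hord.1 hr
  -- `∑ G_k (−2)^k = 0` in `ℤ₂`
  have hn2 : ‖(-2 : ℤ_[2])‖ < 1 := by
    rw [norm_neg, show (2 : ℤ_[2]) = ((2 : ℕ) : ℤ_[2]) by norm_num, PadicInt.norm_p]; norm_num
  have hdvd' : (X - C (-2 : ℤ_[2])) ∣ G := by rwa [map_neg, sub_neg_eq_add]
  have h0 := hasSum_coeff_mul_pow_zero_of_X_sub_C_dvd hn2 hdvd'
  -- its image in `ℂ₂`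
  set φ : ℤ_[2] →+* ℂ_[2] := (algebraMap ℚ_[2] ℂ_[2]).comp (PadicInt.Coe.ringHom (p := 2)) with hφdef
  have hφc : Continuous φ := (continuous_algebraMap ℚ_[2] ℂ_[2]).comp continuous_subtype_val
  have h1 : HasSum (fun k : ℕ ↦ φ (coeff k G * (-2 : ℤ_[2]) ^ k)) (φ 0) := h0.map φ hφc
  rw [map_zero] at h1
  have hcoeff : ∀ k : ℕ, ((coeff k G : ℤ_[2]) : ℚ_[2]) = PowerSeries.coeff k (padicLFunction f (unitRoot W 2 : ℚ_[2])) := fun k ↦ by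
    rw [← hG]; exact (Wuthrich2014.coeff_iwasawaToPowerSeries 2 G k).symm
  have hfun : (fun k : ℕ ↦ φ (coeff k G * (-2 : ℤ_[2]) ^ k)) = fun k ↦
      algebraMap ℚ_[2] ℂ_[2] (PowerSeries.coeff k (padicLFunction f (unitRoot W 2 : ℚ_[2]))) * (-2) ^ k := by
    funext k
    rw [map_mul, map_pow, map_neg, map_ofNat, hφdef, RingHom.comp_apply, ← hcoeff k]
    rfl
  rw [hfun] at h1
  -- MTT: the same series sums to `α⁻³ · S₈(f)`
  have h2 := hasSum_coeff_padicLFunction_two_neg_two hord hf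
  have hval : algebraMap ℚ_[2] ℂ_[2] ((unitRoot W 2 : ℚ_[2])⁻¹ ^ 3) * ratTwistedSymbolSum f (ZMod.χ₈.ringHomComp (Int.castRingHom ℂ_[2])) = 0 :=
    h2.unique h1
  have hα : algebraMap ℚ_[2] ℂ_[2] ((unitRoot W 2 : ℚ_[2])⁻¹ ^ 3) ≠ 0 := by
    rw [map_ne_zero_iff _ (algebraMap ℚ_[2] ℂ_[2]).injective]
    exact pow_ne_zero _ (inv_ne_zero (unitRoot_coe_spec hord).2.2)
  have hS8 : ratTwistedSymbolSum f (ZMod.χ₈.ringHomComp (Int.castRingHom ℂ_[2])) = 0 := (mul_eq_zero.mp hval).resolve_left hα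
  rw [ratTwistedSymbolSum_χ₈_eq_cast f ℂ_[2], Rat.cast_eq_zero] at hS8
  rw [ratTwistedSymbolSum_χ₈_eq_cast f ℂ, hS8, Rat.cast_zero] at hS
  exact hS rfl

/-- ★★ **THE ANALYTIC MATCHING LAW AT THE ORDER-2 CHARACTER, TWO-SIDED: `(T+2) ∣ L₂(W,T) ⟺ L(W⁽²⁾, 1) = 0`** (`⟸` is the tree's
`X_add_C_two_dvd_of_analyticRank_quadraticTwist_two_ne_zero`; `⟹` is the previous theorem). [cite: MazurTateTeitelbaum1986Invent, §I.14 Proposition (p. 20), §I.8 (8.6)] -/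
theorem X_add_C_two_dvd_iff_analyticRank_quadraticTwist_two_ne_zero (hord : IsOrdinaryAt W 2) (hf : IsNewformOf W f)
    {G : IwasawaAlgebra 2} (hG : iwasawaToPowerSeries 2 G = padicLFunction f (unitRoot W 2 : ℚ_[2])) :
    (X + C (2 : ℤ_[2])) ∣ G ↔ (W.quadraticTwist 2).analyticRank ≠ 0 := by
  constructor
  · intro h hr
    exact not_X_add_C_two_dvd_of_analyticRank_quadraticTwist_two_eq_zero hord hf hG hr h
  · intro hr
    refine X_add_C_two_dvd_of_analyticRank_quadraticTwist_two_ne_zero hord hf hr (c := 1) (g := G) ?_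
    rw [map_one, one_mul, ← hG]
    rfl

/-- **`r_an(W⁽²⁾) = 0 ⟹ ord_{T=−2} L₂(W,T) = 0`.** [cite: MazurTateTeitelbaum1986Invent, §I.14 Proposition (p. 20)] -/
theorem hasOrderAtNegTwo_zero_of_analyticRank_quadraticTwist_two_eq_zero (hord : IsOrdinaryAt W 2) (hf : IsNewformOf W f)
    {G : IwasawaAlgebra 2} (hG : iwasawaToPowerSeries 2 G = padicLFunction f (unitRoot W 2 : ℚ_[2]))
    (hr : (W.quadraticTwist 2).analyticRank = 0) : HasOrderAtNegTwo G 0 :=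
  ⟨by rw [pow_zero]; exact one_dvd _, by rw [zero_add, pow_one]; exact not_X_add_C_two_dvd_of_analyticRank_quadraticTwist_two_eq_zero hord hf hG hr⟩

end Analytic

/-! ## §3 With Kato for `W`: `L(W⁽²⁾,1) ≠ 0 ⟹ Sel_{2^∞}(W⁽²⁾/ℚ)` has corank `0`; no Selmer growth at the first layer -/

section Kato

variable (W : WeierstrassCurve ℚ) [W.IsElliptic] [W.IsGloballyMinimal] (W₂ : WeierstrassCurve ℚ) [W₂.IsElliptic]
  {V : VariableChange ℚ} (hV : V • W₂ = W.quadraticTwist 2)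

include hV in
/-- ★★ **`L(W⁽²⁾, 1) ≠ 0 ⟹ corank_{ℤ₂} Sel_{2^∞}(W⁽²⁾/ℚ) = 0`, `rank W⁽²⁾(ℚ) = 0` and `Ш(W⁽²⁾/ℚ)[2^∞]` FINITE** for every `ℚ`-model `W₂` of the additive twist of a good-ordinary `W` at `2`
(PRINT `h17` = Kato 17.4 (1)(2) at `2` for `W`; §2 gives `ord₋₂ L₂(W) = 0`, `…TwistReading` §3 the corank bound, Greenberg §1 `corank Sel = rank + corank Ш` the rest).
[cite: Kato2004Asterisque, Thm. 17.4 (1)(2) (p. 273) and Cor. 14.3] [cite: GreenbergLNM1716, §1 pp. 53–57, §3 Lemma 3.1, §4 p. 107] -/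
theorem selmerCorank_twist_eq_zero_of_analyticRank_quadraticTwist_two_eq_zero {N : ℕ} [NeZero N] {f : CuspForm (Gamma0 N) 2}
    (h17 : kato_divisibility_allPrimes W 2 (f := f)) (hord : IsOrdinaryAt W 2) (hf : IsNewformOf W f)
    (hr : (W.quadraticTwist 2).analyticRank = 0) :
    W₂.selmerCorank 2 = 0 ∧ W₂.mordellWeilRank = 0 ∧ Finite (AddCommGroup.primaryComponent W₂.sha 2) := by
  obtain ⟨G, hG⟩ := exists_iwasawaToPowerSeries_eq_padicLFunction_two_auto hord hf
  obtain ⟨hs, hrk⟩ := selmerCorank_twist_le_orderAtNegTwo W W₂ hV h17 hord hf hG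
    (hasOrderAtNegTwo_zero_of_analyticRank_quadraticTwist_two_eq_zero hord hf hG hr)
  have hs0 : W₂.selmerCorank 2 = 0 := Nat.le_zero.mp hs
  refine ⟨hs0, Nat.le_zero.mp hrk, ?_⟩
  rw [finite_primaryComponent_sha_iff_shaCorank_eq_zero]
  have h := W₂.selmerCorank_eq_mordellWeilRank_add_holds 2
  omega

/-- ★ **`L(W⁽²⁾, 1) ≠ 0 ⟹ NO SELMER GROWTH IN THE FIRST LAYER: `corank_{ℤ₂} Sel_{2^∞}(W/ℚ(√2)) = corank_{ℤ₂} Sel_{2^∞}(W/ℚ)`** (PRINT `h17`; Dokchitser–Dokchitser Lemma 4.14 in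
the tree's proved form). [cite: Kato2004Asterisque, Thm. 17.4 (1)(2) (p. 273)] [cite: DokchitserDokchitserAnnals2010, Lemma 4.14] -/
theorem selmerCorank_layer_one_eq_of_analyticRank_quadraticTwist_two_eq_zero {N : ℕ} [NeZero N] {f : CuspForm (Gamma0 N) 2}
    (h17 : kato_divisibility_allPrimes W 2 (f := f)) (hord : IsOrdinaryAt W 2) (hf : IsNewformOf W f)
    (hr : (W.quadraticTwist 2).analyticRank = 0) {κ : ZpExtension ℚ 2} [NumberField (κ.layer 1)] (hκ : κ.IsCyclotomic) :
    (W.baseChange (κ.layer 1)).selmerCorank 2 = W.selmerCorank 2 := by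
  haveI : (W.quadraticTwist (2 : ℚ)).IsElliptic := W.isElliptic_quadraticTwist two_ne_zero
  obtain ⟨h0, -, -⟩ := selmerCorank_twist_eq_zero_of_analyticRank_quadraticTwist_two_eq_zero W (W.quadraticTwist 2) (V := 1) (one_smul _ _)
    h17 hord hf hr
  rw [selmerCorank_layer_one_eq_add W hκ, h0, add_zero]

end Kato

end Summit.BirchSwinnertonDyer.BirchSwinnertonDyer.Theorems.AlignedTransportAtTwoTwistReadingAnalytic

end
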